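import Mathlib
import Summits.ValiantsHypothesis.ValiantsHypothesis.Theorems.LiouvilleSarnakAlignedTypeICharactersMod2nAssembly
import HarnessLib

/-!
# Route LiouvilleSarnak — support `AlignedTypeI` (stmt-ValiantsHypothesis-21040), line `characters_mod_2n`:
# the crux is EXACTLY the top levels — `AlignedTypeI` ⟺ `ℓ¹`-equidistribution of `λ` at each fixed co-depth

The line reads the crux `Σ_{a<2^n} |Σ_{b<2^n} λ(a+1+2^n b)| ≤ ε 4^n` through the dyadic split
`a + 1 = 2^(n-k) u` (`u` odd): the fibre of level `k ≥ 1` is, in absolute value, the `ℓ¹` sum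
`U(n,k) = Σ_{u ∈ (ℤ/2^k)ˣ} |Σ_{b<2^n} λ(u + 2^k b)|` of `λ` over the odd classes mod `2^k` along `b < 2^n`
(length `2^n` inside `[1, 2^(n+k)]`), and the fibre `k = 0` is `|Σ_{m ≤ 2^n} λ(m)|`.  The companion files
bound `U(n,k)` from the KMT variance (Cauchy–Schwarz).  This file records the EXACT content of the crux:

* `unit_sum_le_row_sum` — `U(n,k) ≤ Σ_{a<2^n} |T_n(a)|` for `1 ≤ k ≤ n` (the split is injective on odd
  `u < 2^k`; the converse inequality per fibre is the tree's `fiber_sum_le_unit_sum`);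
* `alignedTypeI_iff_topLevels` — **`AlignedTypeI` holds if and only if, for every fixed co-depth `j ≥ 0`,
  `U(k+j, k) = o(4^(k+j))` as `k → ∞`**, i.e. `λ` has `o(1)` cancellation in `ℓ¹`-mean over the odd classes
  to modulus `q = 2^k` inside `[1, x]`, `x = 2^j q²`, for each fixed `j` — the regime `q ≍ √x` and nothing
  below it (levels `k ≤ n - J` are trivially `≤ 4^n 2^{-J}`; the fibre `k = 0` is trivially `≤ 2^n`).

Consequences for the planner (honest): the crux is neither weaker nor stronger than the `q ≍ √x` case of
`ℓ¹`-equidistribution of `λ` in progressions to `2`-power moduli; the only result in print covering it is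
Klurman–Mangerel–Teräväinen 2023 Thm 1.3 (variance, smooth moduli, `Q ≤ x/10`), typed as
`Literature.NumberTheory.LFunctions.KMT2023_theorem13_liouville_twoPower` (no `_holds`).  Nothing here is
conditional; `AlignedTypeI` is NOT closed; nothing here bears on `VP ≠ VNP` (NOT proved).
-/

set_option linter.dupNamespace false

noncomputable section

namespace Summit.ValiantsHypothesis.ValiantsHypothesis.Theorems.LiouvilleSarnak.AlignedTypeI.CharactersModTwoN

open ArithmeticFunction Finset
open scoped BigOperators

/-! ## §1 The unit sum of level `k` sits inside the row sums -/

/-- For a unit `u` mod `2^k` (`k ≥ 1`): `1 ≤ u.val`. [folklore] -/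
theorem one_le_val_unit {k : ℕ} (hk1 : 1 ≤ k) (u : (ZMod (2 ^ k))ˣ) : 1 ≤ (u : ZMod (2 ^ k)).val := by
  haveI : Fact (1 < 2 ^ k) := ⟨Nat.one_lt_two_pow (Nat.pos_iff_ne_zero.mp hk1)⟩
  rw [Nat.one_le_iff_ne_zero, ne_eq, ZMod.val_eq_zero]
  exact Units.ne_zero u

/-- The row index of the odd class `u` mod `2^k` at depth `n ≥ k`: `a = 2^(n-k) u - 1 < 2^n`. [folklore] -/
theorem row_index_lt {n k : ℕ} (hkn : k ≤ n) (u : (ZMod (2 ^ k))ˣ) :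
    2 ^ (n - k) * (u : ZMod (2 ^ k)).val - 1 < 2 ^ n := by
  haveI : NeZero (2 ^ k) := ⟨pow_ne_zero _ two_ne_zero⟩
  have hv : (u : ZMod (2 ^ k)).val < 2 ^ k := ZMod.val_lt _
  have h2 : 2 ^ (n - k) * 2 ^ k = 2 ^ n := by rw [← pow_add, Nat.sub_add_cancel hkn]
  have h3 : 2 ^ (n - k) * (u : ZMod (2 ^ k)).val < 2 ^ n := by
    rw [← h2]; exact Nat.mul_lt_mul_of_pos_left hv (Nat.two_pow_pos _)
  omega

/-- **`U(n,k) ≤ Σ_a |T_n(a)|`** for `1 ≤ k ≤ n`: the unit sum of level `k`,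
`Σ_{u ∈ (ℤ/2^k)ˣ} |Σ_{b<2^n} λ(u + 2^k b)|`, is the sum of `|T_n(a)|` over the rows `a = 2^(n-k) u - 1` (distinct),
hence at most the full row sum. [folklore] -/
theorem unit_sum_le_row_sum {n k : ℕ} (hk1 : 1 ≤ k) (hkn : k ≤ n) :
    ∑ u : (ZMod (2 ^ k))ˣ, (|classSum n k (u : ZMod (2 ^ k)).val| : ℝ) ≤
      ∑ a : Fin (2 ^ n), (|rowSum n a| : ℝ) := by
  haveI : NeZero (2 ^ k) := ⟨pow_ne_zero _ two_ne_zero⟩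
  -- the row index map
  set g : (ZMod (2 ^ k))ˣ → Fin (2 ^ n) :=
    fun u => ⟨2 ^ (n - k) * (u : ZMod (2 ^ k)).val - 1, row_index_lt hkn u⟩ with hg
  have hsplit : ∀ u : (ZMod (2 ^ k))ˣ, ((g u : Fin (2 ^ n)) : ℕ) + 1 = 2 ^ (n - k) * (u : ZMod (2 ^ k)).val := by
    intro u
    have h1 : 1 ≤ 2 ^ (n - k) * (u : ZMod (2 ^ k)).val :=
      Nat.one_le_iff_ne_zero.mpr (Nat.mul_ne_zero (pow_ne_zero _ two_ne_zero)
        (Nat.one_le_iff_ne_zero.mp (one_le_val_unit hk1 u)))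
    show 2 ^ (n - k) * (u : ZMod (2 ^ k)).val - 1 + 1 = _
    omega
  have hval : ∀ u : (ZMod (2 ^ k))ˣ, (|classSum n k (u : ZMod (2 ^ k)).val| : ℝ) = (|rowSum n (g u)| : ℝ) := by
    intro u
    exact_mod_cast congrArg (fun z : ℤ => (z : ℝ)) (abs_rowSum_eq_of_split hkn (hsplit u)).symm
  have hinj : Function.Injective g := by
    intro u u' he
    have h := congrArg (fun a : Fin (2 ^ n) => (a : ℕ) + 1) he
    simp only [hsplit] at h
    have h' : (u : ZMod (2 ^ k)).val = (u' : ZMod (2 ^ k)).val :=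
      Nat.eq_of_mul_eq_mul_left (Nat.two_pow_pos _) h
    exact Units.ext (ZMod.val_injective _ h')
  rw [Finset.sum_congr rfl fun u _ => hval u,
    ← Finset.sum_image (f := fun a : Fin (2 ^ n) => (|rowSum n a| : ℝ)) (fun u _ u' _ huu' => hinj huu')]
  exact Finset.sum_le_sum_of_subset_of_nonneg (Finset.subset_univ _) fun _ _ _ => abs_nonneg _

/-! ## §2 The crux is exactly the top levels -/

/-- **`AlignedTypeI` ⟺ `ℓ¹`-equidistribution of `λ` at every fixed co-depth.**  The crux holds if and only
if for every `j ≥ 0` and every `ε > 0` there is `n₀` such that for all `n ≥ n₀` of the form `n = k + j` with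
`k ≥ 1`: `Σ_{u ∈ (ℤ/2^k)ˣ} |Σ_{b<2^n} λ(u + 2^k b)| ≤ ε 4^n`.  (⇒) each unit sum sits inside the row sums
(`unit_sum_le_row_sum`).  (⇐) given `ε`, fix `J` with `2^J ≥ 4/ε`; the levels `k ≤ n - J - 1` contribute
`≤ Σ_{k<n-J} 2^(n+k) ≤ 4^n 2^{-J} ≤ ε 4^n/4` trivially (`fiber_sum_le_trivial`), the level `k = 0` at most
`2^n ≤ ε 4^n/4`, and the `J+1` top levels `n - J ≤ k ≤ n` at most `(J+1) · ε/(4(J+1)) · 4^n` by the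
hypotheses for `j = 0, …, J` (`fiber_sum_le_unit_sum`). [folklore] -/
theorem alignedTypeI_iff_topLevels :
    Summit.ValiantsHypothesis.ValiantsHypothesis.Theses.LiouvilleSarnak.AlignedTypeI ↔
      ∀ j : ℕ, ∀ ε : ℝ, 0 < ε → ∃ n₀ : ℕ, ∀ n k : ℕ, n₀ ≤ n → n = k + j → 1 ≤ k →
        ∑ u : (ZMod (2 ^ k))ˣ,
          |∑ b : Fin (2 ^ n), ((liouville ((u : ZMod (2 ^ k)).val + 2 ^ k * (b : ℕ)) : ℤ) : ℝ)| ≤ ε * 4 ^ n := by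
  -- the two currencies
  have hrow : ∀ n : ℕ, (∑ a : Fin (2 ^ n), |∑ b : Fin (2 ^ n),
      ((liouville ((a : ℕ) + 2 ^ n * (b : ℕ) + 1) : ℤ) : ℝ)|) = ∑ a : Fin (2 ^ n), (|rowSum n a| : ℝ) := by
    intro n
    refine Finset.sum_congr rfl fun a _ => ?_
    rw [rowSum, Int.cast_sum]
  have hunit : ∀ n k : ℕ, (∑ u : (ZMod (2 ^ k))ˣ,
      |∑ b : Fin (2 ^ n), ((liouville ((u : ZMod (2 ^ k)).val + 2 ^ k * (b : ℕ)) : ℤ) : ℝ)|) =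
        ∑ u : (ZMod (2 ^ k))ˣ, (|classSum n k (u : ZMod (2 ^ k)).val| : ℝ) := by
    intro n k
    refine Finset.sum_congr rfl fun u _ => ?_
    rw [classSum, Int.cast_sum]
  constructor
  · -- (⇒)
    intro hA j ε hε
    obtain ⟨n₀, hn₀⟩ := hA ε hε
    refine ⟨n₀, fun n k hn hnk hk1 => ?_⟩
    have hkn : k ≤ n := by omega
    rw [hunit]
    calc ∑ u : (ZMod (2 ^ k))ˣ, (|classSum n k (u : ZMod (2 ^ k)).val| : ℝ)
        ≤ ∑ a : Fin (2 ^ n), (|rowSum n a| : ℝ) := unit_sum_le_row_sum hk1 hkn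
      _ = ∑ a : Fin (2 ^ n), |∑ b : Fin (2 ^ n), ((liouville ((a : ℕ) + 2 ^ n * (b : ℕ) + 1) : ℤ) : ℝ)| :=
          (hrow n).symm
      _ ≤ ε * 4 ^ n := hn₀ n hn
  · -- (⇐)
    intro h ε hε
    -- `J` with `2^J ≥ 4/ε`
    obtain ⟨J, hJ⟩ : ∃ J : ℕ, 4 / ε ≤ (2 : ℝ) ^ J := by
      obtain ⟨J, hJ⟩ := exists_nat_ge (4 / ε)
      exact ⟨J, hJ.trans (by exact_mod_cast (Nat.lt_two_pow_self).le)⟩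
    set ε' : ℝ := ε / (4 * (J + 1)) with hε'
    have hε'0 : 0 < ε' := by positivity
    -- thresholds for the top levels `j ≤ J`
    choose N hN using fun j : ℕ => h j ε' hε'0
    refine ⟨max (J + 1) ((Finset.range (J + 1)).sup N), fun n hn => ?_⟩
    have hnJ : J + 1 ≤ n := le_trans (le_max_left _ _) hn
    have hNn : ∀ j ≤ J, N j ≤ n := fun j hj =>
      le_trans (Finset.le_sup (f := N) (Finset.mem_range.2 (Nat.lt_succ_of_le hj))) (le_trans (le_max_right _ _) hn)
    rw [hrow n, sum_fiberwise]
    -- fibre bounds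
    have hfib : ∀ k ∈ Finset.range (n + 1), ∑ a ∈ fib n k, (|rowSum n a| : ℝ) ≤
        (if k + J < n then (2 : ℝ) ^ n * 2 ^ k else 0) + (if k = 0 then (2 : ℝ) ^ n else 0) +
          (if n ≤ k + J then ε' * 4 ^ n else 0) := by
      intro k hk
      have hkn : k ≤ n := Nat.lt_succ_iff.1 (Finset.mem_range.1 hk)
      have h4n0 : (0 : ℝ) ≤ ε' * 4 ^ n := by positivity
      rcases Nat.eq_zero_or_pos k with rfl | hk1
      · -- level `0`
        rw [if_pos rfl]
        have h0 : ∑ a ∈ fib n 0, (|rowSum n a| : ℝ) ≤ 2 ^ n := by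
          have := fiber_sum_le_trivial (n := n) (k := 0) (Nat.zero_le n)
          rwa [add_zero] at this
        have h1 : (0 : ℝ) ≤ (if 0 + J < n then (2 : ℝ) ^ n * 2 ^ 0 else 0) := by
          split_ifs <;> positivity
        have h2 : (0 : ℝ) ≤ (if n ≤ 0 + J then ε' * 4 ^ n else 0) := by
          split_ifs <;> positivity
        linarith
      · rw [if_neg (by omega : k ≠ 0), add_zero]
        by_cases hlow : k + J < n
        · -- low level: trivial bound
          rw [if_pos hlow, if_neg (by omega : ¬ n ≤ k + J), add_zero]
          calc ∑ a ∈ fib n k, (|rowSum n a| : ℝ) ≤ 2 ^ (n + k) := fiber_sum_le_trivial hkn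
            _ = (2 : ℝ) ^ n * 2 ^ k := by rw [pow_add]
        · -- top level `j = n - k ≤ J`
          rw [if_neg hlow, if_pos (by omega : n ≤ k + J), zero_add]
          have hj : n - k ≤ J := by omega
          have hmain := hN (n - k) n k (hNn (n - k) hj) (by omega) hk1
          rw [hunit] at hmain
          exact (fiber_sum_le_unit_sum hk1 hkn).trans hmain
    -- summing the three kinds of terms
    have hA : ∑ k ∈ Finset.range (n + 1), (if k + J < n then (2 : ℝ) ^ n * 2 ^ k else 0) ≤
        (2 : ℝ) ^ n * 2 ^ (n - J) := by
      rw [← Finset.sum_filter]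
      calc ∑ k ∈ (Finset.range (n + 1)).filter (fun k => k + J < n), (2 : ℝ) ^ n * 2 ^ k
          ≤ ∑ k ∈ Finset.range (n - J), (2 : ℝ) ^ n * 2 ^ k := by
            refine Finset.sum_le_sum_of_subset_of_nonneg ?_ fun _ _ _ => by positivity
            intro k hk
            simp only [Finset.mem_filter, Finset.mem_range] at hk ⊢
            omega
        _ = (2 : ℝ) ^ n * ∑ k ∈ Finset.range (n - J), (2 : ℝ) ^ k := by rw [Finset.mul_sum]
        _ ≤ (2 : ℝ) ^ n * 2 ^ (n - J) := by gcongr; exact sum_two_pow_le (n - J)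
    have hB : ∑ k ∈ Finset.range (n + 1), (if k = 0 then (2 : ℝ) ^ n else 0) = 2 ^ n := by
      rw [Finset.sum_ite_eq' (Finset.range (n + 1)) 0 (fun _ => (2 : ℝ) ^ n), if_pos (by simp)]
    have hC : ∑ k ∈ Finset.range (n + 1), (if n ≤ k + J then ε' * 4 ^ n else 0) ≤ (J + 1) * (ε' * 4 ^ n) := by
      rw [← Finset.sum_filter]
      have hcard : ((Finset.range (n + 1)).filter (fun k => n ≤ k + J)).card ≤ J + 1 := by
        calc ((Finset.range (n + 1)).filter (fun k => n ≤ k + J)).card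
            ≤ (Finset.Icc (n - J) n).card := by
              refine Finset.card_le_card ?_
              intro k hk
              simp only [Finset.mem_filter, Finset.mem_range] at hk
              simp only [Finset.mem_Icc]
              omega
          _ = J + 1 := by rw [Nat.card_Icc]; omega
      calc ∑ k ∈ (Finset.range (n + 1)).filter (fun k => n ≤ k + J), ε' * 4 ^ n
          = ((Finset.range (n + 1)).filter (fun k => n ≤ k + J)).card * (ε' * 4 ^ n) := by
            rw [Finset.sum_const, nsmul_eq_mul]
        _ ≤ (J + 1) * (ε' * 4 ^ n) := by gcongr; exact_mod_cast hcard
    -- numerics: `2^n 2^(n-J) ≤ ε 4^n / 4`, `2^n ≤ ε 4^n / 4`, `(J+1) ε' 4^n = ε 4^n / 4`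
    have h4n : (4 : ℝ) ^ n = (2 : ℝ) ^ n * 2 ^ n := by rw [← mul_pow]; norm_num
    have h2J : (2 : ℝ) ^ n = 2 ^ (n - J) * 2 ^ J := by rw [← pow_add, Nat.sub_add_cancel (by omega)]
    have hJε : 4 ≤ ε * (2 : ℝ) ^ J := by rwa [div_le_iff₀ hε, mul_comm] at hJ
    have h1 : (2 : ℝ) ^ n * 2 ^ (n - J) ≤ ε / 4 * 4 ^ n := by
      rw [h4n, h2J]
      have h0 : (0 : ℝ) ≤ 2 ^ (n - J) * 2 ^ (n - J) * 2 ^ J := by positivity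
      nlinarith
    have h2 : (2 : ℝ) ^ n ≤ ε / 4 * 4 ^ n := by
      rw [h4n]
      have hJn : (2 : ℝ) ^ J ≤ 2 ^ n := pow_le_pow_right₀ (by norm_num) (by omega)
      have h0 : (0 : ℝ) ≤ 2 ^ n := by positivity
      have h5 : 4 ≤ ε * (2 : ℝ) ^ n := hJε.trans (mul_le_mul_of_nonneg_left hJn hε.le)
      have h6 := mul_le_mul_of_nonneg_right h5 h0
      nlinarith
    have h3 : (J + 1) * (ε' * (4 : ℝ) ^ n) = ε / 4 * 4 ^ n := by
      rw [hε']; field_simp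
    calc ∑ k ∈ Finset.range (n + 1), ∑ a ∈ fib n k, (|rowSum n a| : ℝ)
        ≤ ∑ k ∈ Finset.range (n + 1), ((if k + J < n then (2 : ℝ) ^ n * 2 ^ k else 0) +
            (if k = 0 then (2 : ℝ) ^ n else 0) + (if n ≤ k + J then ε' * 4 ^ n else 0)) :=
          Finset.sum_le_sum hfib
      _ = ∑ k ∈ Finset.range (n + 1), (if k + J < n then (2 : ℝ) ^ n * 2 ^ k else 0) +
            ∑ k ∈ Finset.range (n + 1), (if k = 0 then (2 : ℝ) ^ n else 0) +
            ∑ k ∈ Finset.range (n + 1), (if n ≤ k + J then ε' * 4 ^ n else 0) := by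
          rw [Finset.sum_add_distrib, Finset.sum_add_distrib]
      _ ≤ (2 : ℝ) ^ n * 2 ^ (n - J) + 2 ^ n + (J + 1) * (ε' * 4 ^ n) := by rw [hB]; gcongr
      _ ≤ ε / 4 * 4 ^ n + ε / 4 * 4 ^ n + ε / 4 * 4 ^ n := by rw [h3]; gcongr
      _ ≤ ε * 4 ^ n := by nlinarith [pow_pos (by norm_num : (0 : ℝ) < 4) n]

/-- **The crux implies the `q = √x` case** (co-depth `j = 0`): if `AlignedTypeI` then for every `ε > 0` and
all large `k`, `Σ_{u ∈ (ℤ/2^k)ˣ} |Σ_{b<2^k} λ(u + 2^k b)| ≤ ε 4^k` — `λ` is `ℓ¹`-equidistributed over the odd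
classes to modulus `2^k = √x` inside `[1, x]`, `x = 4^k`. [folklore] -/
theorem sqrt_level_of_alignedTypeI
    (hA : Summit.ValiantsHypothesis.ValiantsHypothesis.Theses.LiouvilleSarnak.AlignedTypeI) :
    ∀ ε : ℝ, 0 < ε → ∃ k₀ : ℕ, ∀ k ≥ k₀,
      ∑ u : (ZMod (2 ^ k))ˣ,
        |∑ b : Fin (2 ^ k), ((liouville ((u : ZMod (2 ^ k)).val + 2 ^ k * (b : ℕ)) : ℤ) : ℝ)| ≤ ε * 4 ^ k := by
  intro ε hε
  obtain ⟨n₀, hn₀⟩ := (alignedTypeI_iff_topLevels.mp hA) 0 ε hε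
  exact ⟨max n₀ 1, fun k hk => hn₀ k k (le_trans (le_max_left _ _) hk) (by omega) (le_trans (le_max_right _ _) hk)⟩

end Summit.ValiantsHypothesis.ValiantsHypothesis.Theorems.LiouvilleSarnak.AlignedTypeI.CharactersModTwoN
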